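import Summits.BirchSwinnertonDyer.BirchSwinnertonDyer.Theorems.EisensteinPrimesWeightResiduePencil
import Literature.NumberTheory.EllipticCurves.PadicSeriesEvaluation
import HarnessLib

/-!
# Specialisation rigidity of `μ` and `λ` in a one-parameter family over `Λ_S = ℤ_p⟦S⟧` — MEMO-24 §1 (b)
# CLAIM 1 («all weights reduce through the same map»), (i) (Emerton–Pollack–Weston's constancy of `λ`
# along a branch, irreducibility-free algebraic core), (ii) (the dead branch) and the β-branch criterion
# behind (iii), as kernel algebra (cell `bsd-eis`, seat `bsd-line-x2-p2` gen 2, D-0154 KEY row 5; route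
# `EisensteinPrimes`, crux 4 `BSDpOnCellC` stmt-BirchSwinnertonDyer-19034 line b1 v10 / crux 3
# `MazurMCOnCellB`; memo `HOME/cgshw-MEMO-24.md` §1 (b)–(c); companions p606630 `…SymbolLineRigidity`,
# p607009 `…WeightResiduePencil`)

HONEST FRAMING (cell `bsd-eis`, run/shared/lean/pub/bsd-eis/): pure commutative algebra of
`Λ_S = ℤ_p⟦S⟧` (the weight algebra of the memo) and of two-variable series `G ∈ Λ_S⟦T⟧`, everything
PROVED (Mathlib + the tree's `X1.MuLambda` API + the two companion files); NO Hida family, `Λ`-adic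
modular symbol, two-variable `p`-adic `L`-function or Hecke algebra is constructed or asserted — the
memo's identification «`G` = the Mazur–Kitagawa / Greenberg–Stevens two-variable `L`-function of the
branch, `map φ_k G` = `c_k ·` the `p`-adic `L`-function of the weight-`k` member» stays at memo level
(its CLAIM 2); nothing is booked; X2 stays CONSTRUCTION-SHAPED; no label or count moves; BSD and the
main conjectures are proved for no curve. Helper attached to stmt-BirchSwinnertonDyer-19034.

## The point

MEMO-24 §1 (b) argues: a branch `𝕀 = Λ_S` of the Hida family carries ONE two-variable object `G`
(there: `L_p(Φ₀) ∈ Λ_S⟦T⟧`); the member of even weight `k` is the SPECIALISATION of `G` along the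
`ℤ_p`-point `φ_k : Λ_S → ℤ_p`, `S ↦ s_k = (1+p)^{k−2} − 1`; CLAIM 1: «`Φ(x) mod ϖ_x = Φ̄` because
`ker(Λ → 𝒪_x → k_x) = 𝔪_Λ` for EVERY `x`: all weights reduce through the same map»; hence (i) if the
double reduction `Ḡ ∈ 𝔽_p⟦T⟧` is non-zero, EVERY member is `μ`-primitive with the SAME `λ = ord_T Ḡ`
(EPW 2006 Thm. 3.7.5 / Cor. 2 with the irreducibility hypothesis removed where it is idle), (ii) if
`Ḡ = 0` every member has `μ ≥ 1`, and (iii) on a β-branch `G = p·A + S·B` the member runs through the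
pencil `Ā + (k−2)̄·B̄` (typed by p607009 from the two-line shape as a HYPOTHESIS). This file proves the
algebra behind all four sentences, for an ARBITRARY ring map `φ : Λ_S → ℤ_p` (no locality hypothesis
is needed — §1):

* §1 `residue_apply_eq_residue_constantCoeff` — for EVERY ring map `φ : ℤ_p⟦S⟧ → ℤ_p` and every `x`,
  `φ(x) ≡ x(0) (mod p)`: `residue ∘ φ = residue ∘ (S ↦ 0)` (`ker` is the maximal ideal because
  `residue ∘ φ` is onto `𝔽_p`; CLAIM 1's «same map»).
* §2 `red_map_specialisation` — the reduction of every specialisation `map φ G ∈ Λ = ℤ_p⟦T⟧` is ONE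
  series `Ḡ := map (residue ∘ constantCoeff) G ∈ 𝔽_p⟦T⟧`, independent of `φ`.
* §3 rigidity — `Ḡ ≠ 0` ⇒ every specialisation is non-zero, `μ = 0`, `λ = ord_T Ḡ`; two
  specialisations have equal `λ` (`lam_map_eq_lam_map`); one `μ`-primitive member certifies all.
* §4 dead branch — `Ḡ = 0` ⇒ `p ∣ map φ G` for every `φ` (`μ ≥ 1` on every non-zero member).
* §5 β-criterion — `Ḡ = 0 ⟺` every coefficient of `G` lies in `𝔪_{Λ_S} = (p, S) ⟺ G = p·A + S·B`
  for some `A, B` (the two-line model of MEMO-23 §5 / MEMO-24 §1 (b)(iii) EXISTS exactly on β-branches).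
* §6 the bracket — for `G = p·A + S·B` and `φ(S) = p·t`: `map φ G = p·(A_φ + t·B_φ)` with
  `red (A_φ + t·B_φ) = Ā + t̄·B̄`; at the weight point `φ(S) = (1+p)^n − 1` the residue is `t̄ = n̄`
  (p607009 `residue_weightQuotient_eq_natCast`), so the companion's `lam_eq_lam_of_modEq` applies
  verbatim: `λ` of the bracket depends on `n mod p` only (`lam_bracket_eq_of_modEq`).
* §7 the weight points exist as ring maps (`evalHom ((1+p)^n − 1)`, Mathlib `eval₂Hom`; `S ↦ s_n`), so
  §6 is inhabited at every weight (`lam_bracket_evalHom_eq_of_modEq`).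

References: [EmertonPollackWeston2006] Thm. 3.7.5, Cor. 2 (shape; irreducibility not used here);
[GreenbergStevens1993] Thm. (6.1) p. 438 (the specialisation formalism, memo level);
[Washington1997] §7.1; cell memo cgshw MEMO-24 §1 (b)–(c) e922e989f5e38c02, MEMO-23 §5 (F-D).
-/

set_option autoImplicit false
set_option linter.dupNamespace false -- the summit namespace `…BirchSwinnertonDyer.BirchSwinnertonDyer.Theorems` (Sub = Summit, D-0017) trips it

noncomputable section

open scoped Classical

open Literature.NumberTheory.EllipticCurves Summit.BirchSwinnertonDyer.Rank1Residual.X1.MuLambda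
  IsLocalRing PowerSeries

namespace Summit.BirchSwinnertonDyer.BirchSwinnertonDyer.Theorems.HidaSpecialisationRigidity

variable {p : ℕ} [Fact p.Prime]

/-! ## §1. Residue rigidity: every ring map `ℤ_p⟦S⟧ → ℤ_p` reduces through `S ↦ 0` -/

/-- For every ring map `φ : ℤ_p⟦S⟧ → ℤ_p`, `residue ∘ φ : ℤ_p⟦S⟧ → 𝔽_p` is onto (every residue is
the residue of a natural number). [folklore] -/
theorem residue_comp_surjective (φ : PowerSeries ℤ_[p] →+* ℤ_[p]) :
    Function.Surjective ((residue ℤ_[p]).comp φ) := by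
  intro y
  obtain ⟨z, rfl⟩ := residue_surjective y
  refine ⟨(z.zmodRepr : PowerSeries ℤ_[p]), ?_⟩
  rw [RingHom.comp_apply, map_natCast]
  exact ((Ideal.Quotient.mk_eq_mk_iff_sub_mem _ _).mpr (PadicInt.sub_zmodRepr_mem (x := z))).symm

/-- Hence its kernel is THE maximal ideal `(p, S)` of the local ring `ℤ_p⟦S⟧` — for EVERY `φ`
(MEMO-24 §1 (b) CLAIM 1: «`ker(Λ → 𝒪_x → k_x) = 𝔪_Λ` for every `x`»). [folklore] -/
theorem ker_residue_comp_eq_maximalIdeal (φ : PowerSeries ℤ_[p] →+* ℤ_[p]) :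
    RingHom.ker ((residue ℤ_[p]).comp φ) = maximalIdeal (PowerSeries ℤ_[p]) :=
  eq_maximalIdeal (RingHom.ker_isMaximal_of_surjective _ (residue_comp_surjective φ))

/-- A power series with non-unit constant term lies in the maximal ideal of `ℤ_p⟦S⟧`. [folklore] -/
theorem mem_maximalIdeal_of_constantCoeff {x : PowerSeries ℤ_[p]}
    (hx : constantCoeff x ∈ maximalIdeal ℤ_[p]) : x ∈ maximalIdeal (PowerSeries ℤ_[p]) := by
  rw [mem_maximalIdeal, mem_nonunits_iff, PowerSeries.isUnit_iff_constantCoeff]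
  exact (mem_maximalIdeal _).mp hx

/-- The maximal ideal of `ℤ_p⟦S⟧` read on the constant term: `x ∈ 𝔪 ⟺ x(0) ∈ pℤ_p`. [folklore] -/
theorem mem_maximalIdeal_iff_constantCoeff (x : PowerSeries ℤ_[p]) :
    x ∈ maximalIdeal (PowerSeries ℤ_[p]) ↔ constantCoeff x ∈ maximalIdeal ℤ_[p] := by
  rw [mem_maximalIdeal, mem_maximalIdeal, mem_nonunits_iff, mem_nonunits_iff,
    PowerSeries.isUnit_iff_constantCoeff]

/-- **Residue rigidity (CLAIM 1, kernel form).** For EVERY ring map `φ : ℤ_p⟦S⟧ → ℤ_p` and every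
`x ∈ ℤ_p⟦S⟧`: `φ(x) ≡ x(0) (mod p)`. No continuity / locality hypothesis on `φ` is needed: `x − x(0)`
and `x(0) − n` (for the digit `n ≡ x(0)`) lie in `ker(residue ∘ φ) = 𝔪`. [folklore] -/
theorem residue_apply_eq_residue_constantCoeff (φ : PowerSeries ℤ_[p] →+* ℤ_[p])
    (x : PowerSeries ℤ_[p]) : residue ℤ_[p] (φ x) = residue ℤ_[p] (constantCoeff x) := by
  have hker : ∀ y ∈ maximalIdeal (PowerSeries ℤ_[p]), residue ℤ_[p] (φ y) = 0 := fun y hy ↦ by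
    have : y ∈ RingHom.ker ((residue ℤ_[p]).comp φ) := by
      rw [ker_residue_comp_eq_maximalIdeal]; exact hy
    exact this
  set c : ℤ_[p] := constantCoeff x with hc
  have h1 : x - C c ∈ maximalIdeal (PowerSeries ℤ_[p]) :=
    mem_maximalIdeal_of_constantCoeff (by rw [map_sub, constantCoeff_C, hc, sub_self]; exact zero_mem _)
  have h2 : C c - (c.zmodRepr : PowerSeries ℤ_[p]) ∈ maximalIdeal (PowerSeries ℤ_[p]) :=
    mem_maximalIdeal_of_constantCoeff
      (by rw [map_sub, constantCoeff_C, map_natCast]; exact PadicInt.sub_zmodRepr_mem (p := p) (x := c))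
  have e1 : residue ℤ_[p] (φ x) = residue ℤ_[p] (φ (C c)) := by
    rw [← sub_eq_zero, ← map_sub, ← map_sub]; exact hker _ h1
  have e2 : residue ℤ_[p] (φ (C c)) = residue ℤ_[p] (c.zmodRepr : ℤ_[p]) := by
    rw [← sub_eq_zero, ← map_natCast φ, ← map_sub, ← map_sub]; exact hker _ h2
  have e3 : residue ℤ_[p] (c.zmodRepr : ℤ_[p]) = residue ℤ_[p] c :=
    ((Ideal.Quotient.mk_eq_mk_iff_sub_mem _ _).mpr (PadicInt.sub_zmodRepr_mem (x := c))).symm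
  rw [e1, e2, e3]

/-- **All points reduce through the same map**: `residue ∘ φ = residue ∘ (S ↦ 0)` as ring maps
`ℤ_p⟦S⟧ → 𝔽_p`, for every `φ`. [folklore] -/
theorem residue_comp_eq (φ : PowerSeries ℤ_[p] →+* ℤ_[p]) :
    (residue ℤ_[p]).comp φ = (residue ℤ_[p]).comp constantCoeff :=
  RingHom.ext (residue_apply_eq_residue_constantCoeff φ)

/-! ## §2. The reduction of every specialisation is one series `Ḡ ∈ 𝔽_p⟦T⟧` -/

/-- **`red (map φ G) = Ḡ`** for every two-variable `G ∈ ℤ_p⟦S⟧⟦T⟧` and every `φ : ℤ_p⟦S⟧ → ℤ_p`,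
where `Ḡ := map (residue ∘ constantCoeff) G` is `G mod (p, S)` — the reduction of a specialisation
does not depend on the specialisation. (`X1.MuLambda.red` = coefficientwise residue.) [folklore] -/
theorem red_map_specialisation (φ : PowerSeries ℤ_[p] →+* ℤ_[p])
    (G : PowerSeries (PowerSeries ℤ_[p])) :
    red (PowerSeries.map φ G) = PowerSeries.map ((residue ℤ_[p]).comp constantCoeff) G := by
  show PowerSeries.map (residue ℤ_[p]) (PowerSeries.map φ G) = _
  rw [← residue_comp_eq φ, PowerSeries.map_comp, RingHom.comp_apply]

/-- Two specialisations have the same reduction. [folklore] -/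
theorem red_map_eq_red_map (φ₁ φ₂ : PowerSeries ℤ_[p] →+* ℤ_[p])
    (G : PowerSeries (PowerSeries ℤ_[p])) :
    red (PowerSeries.map φ₁ G) = red (PowerSeries.map φ₂ G) := by
  rw [red_map_specialisation, red_map_specialisation]

/-! ## §3. Rigidity: `Ḡ ≠ 0` ⇒ every member is `μ`-primitive with `λ = ord_T Ḡ` -/

/-- **EPW rigidity, algebraic core (MEMO-24 §1 (b)(i)).** If `Ḡ ≠ 0` then EVERY specialisation
`map φ G` is non-zero, has `μ = 0`, and `λ(map φ G) = ord_T Ḡ` (in `ℕ∞`) — one number for the whole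
branch, with no irreducibility, Gorenstein or normalisation input. [cite: EmertonPollackWeston2006, Thm. 3.7.5 and Cor. 2 (shape; irreducibility not used)] -/
theorem mu_eq_zero_and_lam_eq_order (φ : PowerSeries ℤ_[p] →+* ℤ_[p])
    {G : PowerSeries (PowerSeries ℤ_[p])}
    (hG : PowerSeries.map ((residue ℤ_[p]).comp constantCoeff) G ≠ 0) :
    PowerSeries.map φ G ≠ 0 ∧ mu (PowerSeries.map φ G) = 0 ∧
      (lam (PowerSeries.map φ G) : ℕ∞) =
        (PowerSeries.map ((residue ℤ_[p]).comp constantCoeff) G).order := by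
  have hred : red (PowerSeries.map φ G) ≠ 0 := by rwa [red_map_specialisation]
  have h0 : PowerSeries.map φ G ≠ 0 := by
    rintro h; exact hred (by rw [h]; exact map_zero _)
  have h := Rank1Residual.Supersingular.mu_eq_zero_and_lam_eq_of_red_ne_zero hred
  rw [red_map_specialisation] at h
  exact ⟨h0, h⟩

/-- **`λ` is constant along the branch**: for `Ḡ ≠ 0`, any two specialisations have the same `λ`
(and both have `μ = 0`). [cite: EmertonPollackWeston2006, Thm. 3.7.5 and Cor. 2 (shape; irreducibility not used)] -/
theorem lam_map_eq_lam_map (φ₁ φ₂ : PowerSeries ℤ_[p] →+* ℤ_[p])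
    {G : PowerSeries (PowerSeries ℤ_[p])}
    (hG : PowerSeries.map ((residue ℤ_[p]).comp constantCoeff) G ≠ 0) :
    mu (PowerSeries.map φ₁ G) = 0 ∧ mu (PowerSeries.map φ₂ G) = 0 ∧
      lam (PowerSeries.map φ₁ G) = lam (PowerSeries.map φ₂ G) := by
  obtain ⟨-, hμ1, hl1⟩ := mu_eq_zero_and_lam_eq_order φ₁ hG
  obtain ⟨-, hμ2, hl2⟩ := mu_eq_zero_and_lam_eq_order φ₂ hG
  exact ⟨hμ1, hμ2, by exact_mod_cast hl1.trans hl2.symm⟩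

/-- **One `μ`-primitive member certifies the branch**: if SOME specialisation `map φ₀ G` is non-zero
with `μ = 0`, then `Ḡ ≠ 0` (so §3 applies to every `φ`). [cite: GreenbergVatsal2000, p. 2–3, (1)–(2)] -/
theorem redFam_ne_zero_of_mu_eq_zero (φ₀ : PowerSeries ℤ_[p] →+* ℤ_[p])
    {G : PowerSeries (PowerSeries ℤ_[p])} (h0 : PowerSeries.map φ₀ G ≠ 0)
    (hμ : mu (PowerSeries.map φ₀ G) = 0) :
    PowerSeries.map ((residue ℤ_[p]).comp constantCoeff) G ≠ 0 := by
  rw [← red_map_specialisation φ₀]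
  exact Rank1Residual.Supersingular.red_ne_zero_of_mu_eq_zero h0 hμ

/-- **Transfer between two members**: if `map φ₀ G ≠ 0` has `μ = 0`, then every `map φ G` is non-zero
with `μ = 0` and `λ(map φ G) = λ(map φ₀ G)`. [cite: EmertonPollackWeston2006, Thm. 3.7.5 and Cor. 2 (shape; irreducibility not used)] -/
theorem mu_eq_zero_and_lam_eq_of_member (φ₀ φ : PowerSeries ℤ_[p] →+* ℤ_[p])
    {G : PowerSeries (PowerSeries ℤ_[p])} (h0 : PowerSeries.map φ₀ G ≠ 0)
    (hμ : mu (PowerSeries.map φ₀ G) = 0) :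
    PowerSeries.map φ G ≠ 0 ∧ mu (PowerSeries.map φ G) = 0 ∧
      lam (PowerSeries.map φ G) = lam (PowerSeries.map φ₀ G) := by
  have hG := redFam_ne_zero_of_mu_eq_zero φ₀ h0 hμ
  obtain ⟨hne, -, -⟩ := mu_eq_zero_and_lam_eq_order φ hG
  obtain ⟨hμ', -, hl⟩ := lam_map_eq_lam_map φ φ₀ hG
  exact ⟨hne, hμ', hl⟩

/-! ## §4. The dead branch: `Ḡ = 0` ⇒ `p ∣` every member -/

/-- **MEMO-24 §1 (b)(ii): `Ḡ = 0` ⇒ `p ∣ map φ G` for every `φ`** (every member has positive `μ`, or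
vanishes). [cite: GreenbergVatsal2000, p. 2–3, (1)–(2)] -/
theorem C_dvd_map_of_redFam_eq_zero (φ : PowerSeries ℤ_[p] →+* ℤ_[p])
    {G : PowerSeries (PowerSeries ℤ_[p])}
    (hG : PowerSeries.map ((residue ℤ_[p]).comp constantCoeff) G = 0) :
    PowerSeries.C (p : ℤ_[p]) ∣ PowerSeries.map φ G := by
  rw [← red_eq_zero_iff, red_map_specialisation, hG]

/-- `Ḡ = 0` and `map φ G ≠ 0` ⇒ `1 ≤ μ(map φ G)`. [cite: GreenbergVatsal2000, p. 2–3, (1)–(2)] -/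
theorem one_le_mu_map_of_redFam_eq_zero (φ : PowerSeries ℤ_[p] →+* ℤ_[p])
    {G : PowerSeries (PowerSeries ℤ_[p])}
    (hG : PowerSeries.map ((residue ℤ_[p]).comp constantCoeff) G = 0)
    (h0 : PowerSeries.map φ G ≠ 0) : 1 ≤ mu (PowerSeries.map φ G) :=
  le_mu_of_C_pow_dvd h0 (by rw [pow_one]; exact C_dvd_map_of_redFam_eq_zero φ hG)

/-- **Dichotomy on one member**: for any `φ₀` with `map φ₀ G ≠ 0`, `Ḡ ≠ 0 ⟺ μ(map φ₀ G) = 0`; so the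
branch type (rigid vs dead) is read off any single non-zero member. [cite: GreenbergVatsal2000, p. 2–3, (1)–(2)] -/
theorem redFam_ne_zero_iff_mu_eq_zero (φ₀ : PowerSeries ℤ_[p] →+* ℤ_[p])
    {G : PowerSeries (PowerSeries ℤ_[p])} (h0 : PowerSeries.map φ₀ G ≠ 0) :
    PowerSeries.map ((residue ℤ_[p]).comp constantCoeff) G ≠ 0 ↔ mu (PowerSeries.map φ₀ G) = 0 := by
  refine ⟨fun hG ↦ (mu_eq_zero_and_lam_eq_order φ₀ hG).2.1, redFam_ne_zero_of_mu_eq_zero φ₀ h0⟩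

/-! ## §5. The β-criterion: `Ḡ = 0 ⟺` every coefficient in `(p, S) ⟺ G = p·A + S·B` -/

/-- A coefficient of `Ḡ` vanishes iff the corresponding coefficient of `G` lies in `𝔪_{Λ_S}`. [folklore] -/
theorem coeff_redFam_eq_zero_iff (G : PowerSeries (PowerSeries ℤ_[p])) (n : ℕ) :
    coeff n (PowerSeries.map ((residue ℤ_[p]).comp constantCoeff) G) = 0 ↔
      coeff n G ∈ maximalIdeal (PowerSeries ℤ_[p]) := by
  rw [coeff_map, RingHom.comp_apply, residue_eq_zero_iff, mem_maximalIdeal_iff_constantCoeff]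

/-- `Ḡ = 0` iff every coefficient of `G` lies in the maximal ideal `(p, S)` of `ℤ_p⟦S⟧`
(«`Φ₀ ∈ 𝔪_Λ𝕎`» of MEMO-24 §1 (b)(iii), coefficientwise). [folklore] -/
theorem redFam_eq_zero_iff_forall_mem (G : PowerSeries (PowerSeries ℤ_[p])) :
    PowerSeries.map ((residue ℤ_[p]).comp constantCoeff) G = 0 ↔
      ∀ n, coeff n G ∈ maximalIdeal (PowerSeries ℤ_[p]) := by
  rw [PowerSeries.ext_iff]
  exact forall_congr' fun n ↦ by rw [map_zero, coeff_redFam_eq_zero_iff]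

/-- The maximal ideal of `ℤ_p⟦S⟧` is `(p, S)`: `x ∈ 𝔪 ⟺ x = p·a + S·b`. [folklore] -/
theorem mem_maximalIdeal_iff_exists (x : PowerSeries ℤ_[p]) :
    x ∈ maximalIdeal (PowerSeries ℤ_[p]) ↔
      ∃ a b : PowerSeries ℤ_[p], x = C (p : ℤ_[p]) * a + X * b := by
  constructor
  · intro hx
    have hc := (mem_maximalIdeal_iff_constantCoeff x).mp hx
    rw [PadicInt.maximalIdeal_eq_span_p, Ideal.mem_span_singleton] at hc
    obtain ⟨a0, ha0⟩ := hc
    refine ⟨C a0, PowerSeries.mk fun i ↦ coeff (i + 1) x, ?_⟩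
    calc x = (X * PowerSeries.mk fun i ↦ coeff (i + 1) x) + C (constantCoeff x) :=
          eq_X_mul_shift_add_const x
      _ = C (p : ℤ_[p]) * C a0 + X * PowerSeries.mk fun i ↦ coeff (i + 1) x := by
          rw [ha0, map_mul, add_comm]
  · rintro ⟨a, b, rfl⟩
    refine mem_maximalIdeal_of_constantCoeff ?_
    rw [map_add, map_mul, map_mul, constantCoeff_C, constantCoeff_X, zero_mul, add_zero,
      PadicInt.maximalIdeal_eq_span_p]
    exact Ideal.mul_mem_right _ _ (Ideal.mem_span_singleton_self _)

/-- **β-criterion (MEMO-24 §1 (b)(iii) / MEMO-23 §5 (F-D)): the two-line model EXISTS exactly when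
`Ḡ = 0`.** `Ḡ = 0 ⟺ ∃ A B, G = p·A + S·B` in `ℤ_p⟦S⟧⟦T⟧` (here `p = C (C p)`, `S = C X`). The companion
p607009 takes `Φ₀ = p·Ψ + s·Ξ` as a hypothesis; this is its provenance. [folklore] -/
theorem redFam_eq_zero_iff_exists_two_line (G : PowerSeries (PowerSeries ℤ_[p])) :
    PowerSeries.map ((residue ℤ_[p]).comp constantCoeff) G = 0 ↔
      ∃ A B : PowerSeries (PowerSeries ℤ_[p]),
        G = C (C (p : ℤ_[p])) * A + C (X : PowerSeries ℤ_[p]) * B := by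
  constructor
  · intro h
    rw [redFam_eq_zero_iff_forall_mem] at h
    choose a b hab using fun n ↦ (mem_maximalIdeal_iff_exists _).mp (h n)
    refine ⟨PowerSeries.mk a, PowerSeries.mk b, PowerSeries.ext fun n ↦ ?_⟩
    rw [map_add, coeff_C_mul, coeff_C_mul, coeff_mk, coeff_mk, hab n]
  · rintro ⟨A, B, rfl⟩
    refine PowerSeries.ext fun n ↦ ?_
    rw [map_zero, coeff_redFam_eq_zero_iff, map_add, coeff_C_mul, coeff_C_mul]
    exact (mem_maximalIdeal_iff_exists _).mpr ⟨coeff n A, coeff n B, rfl⟩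

/-! ## §6. The bracket of a β-branch member and its reduction (feeds p607009's pencil) -/

/-- **Factor `p` out of a β-branch member.** If `G = p·A + S·B` and `φ(S) = p·t` then
`map φ G = p · (A_φ + t·B_φ)` with `A_φ = map φ A`, `B_φ = map φ B` (the member's `L`-function has
`μ^{fam} = 1`, its primitive part is the BRACKET). [folklore] -/
theorem map_two_line_eq_C_mul_bracket {G A B : PowerSeries (PowerSeries ℤ_[p])}
    (hG : G = C (C (p : ℤ_[p])) * A + C (X : PowerSeries ℤ_[p]) * B)
    (φ : PowerSeries ℤ_[p] →+* ℤ_[p]) {t : ℤ_[p]} (hφ : φ X = (p : ℤ_[p]) * t) :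
    PowerSeries.map φ G =
      C (p : ℤ_[p]) * (PowerSeries.map φ A + C t * PowerSeries.map φ B) := by
  have hp : φ (C (p : ℤ_[p])) = (p : ℤ_[p]) := by rw [map_natCast, map_natCast]
  rw [hG, map_add, map_mul, map_mul, map_C, map_C, hp, hφ, map_mul]
  ring

/-- **The bracket reduces to the pencil member `Ā + t̄·B̄`**: `red (A_φ + t·B_φ) = Ā + (t mod p)•B̄`
with `Ā = A mod (p,S)`, `B̄ = B mod (p,S)` INDEPENDENT of `φ` (§2). [folklore] -/
theorem red_bracket (φ : PowerSeries ℤ_[p] →+* ℤ_[p]) (A B : PowerSeries (PowerSeries ℤ_[p]))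
    (t : ℤ_[p]) :
    red (PowerSeries.map φ A + C t * PowerSeries.map φ B) =
      PowerSeries.map ((residue ℤ_[p]).comp constantCoeff) A +
        residue ℤ_[p] t • PowerSeries.map ((residue ℤ_[p]).comp constantCoeff) B := by
  rw [← red_map_specialisation φ A, ← red_map_specialisation φ B, smul_eq_C_mul]
  show PowerSeries.map _ _ = _
  rw [map_add, map_mul, map_C]

/-- **At the weight point the pencil parameter is the weight residue.** If `φ(S) = (1+p)^n − 1` (the
weight-`(n+2)` specialisation of the memo, `s_k = (1+p)^{k−2} − 1`) then there is `t` with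
`φ(S) = p·t`, `map φ G = p·(A_φ + t·B_φ)` and `red (A_φ + t·B_φ) = Ā + n̄•B̄` — exactly the hypothesis
shape `red (L n) = Ā + n̄•B̄` of p607009's `WeightResiduePencil.lam_eq_lam_of_modEq` /
`min_lam_le_lam_of_natCast_ne`. [folklore] -/
theorem exists_bracket_weight {G A B : PowerSeries (PowerSeries ℤ_[p])}
    (hG : G = C (C (p : ℤ_[p])) * A + C (X : PowerSeries ℤ_[p]) * B)
    (φ : PowerSeries ℤ_[p] →+* ℤ_[p]) {n : ℕ} (hφ : φ X = (1 + (p : ℤ_[p])) ^ n - 1) :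
    ∃ t : ℤ_[p], φ X = (p : ℤ_[p]) * t ∧
      PowerSeries.map φ G = C (p : ℤ_[p]) * (PowerSeries.map φ A + C t * PowerSeries.map φ B) ∧
      red (PowerSeries.map φ A + C t * PowerSeries.map φ B) =
        PowerSeries.map ((residue ℤ_[p]).comp constantCoeff) A +
          (n : ResidueField ℤ_[p]) • PowerSeries.map ((residue ℤ_[p]).comp constantCoeff) B := by
  obtain ⟨t, ht, hres⟩ := WeightResiduePencil.exists_weightQuotient (p := p) n
  have hφ' : φ X = (p : ℤ_[p]) * t := by rw [hφ, ht]
  exact ⟨t, hφ', map_two_line_eq_C_mul_bracket hG φ hφ', by rw [red_bracket, hres]⟩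

/-- **`λ` of the β-branch member depends on the weight residue only (MEMO-24 §1 (b)(iii), now from the
two-variable object).** For `G = p·A + S·B`, weight specialisations `φ n` (`(φ n)(S) = (1+p)^n − 1`) with
brackets `L n` (`map (φ n) G = p · L n`), and `n ≡ m (mod p)` with `Ā + n̄•B̄ ≠ 0`: `λ(L n) = λ(L m)`
— p607009's `lam_eq_lam_of_modEq` fed by `exists_bracket_weight`; the brackets are determined by
`map (φ n) G = p · L n` (`Λ` is a domain). [folklore] -/
theorem lam_bracket_eq_of_modEq {G A B : PowerSeries (PowerSeries ℤ_[p])}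
    (hG : G = C (C (p : ℤ_[p])) * A + C (X : PowerSeries ℤ_[p]) * B)
    (φ : ℕ → (PowerSeries ℤ_[p] →+* ℤ_[p])) (hφ : ∀ n, φ n X = (1 + (p : ℤ_[p])) ^ n - 1)
    (L : ℕ → IwasawaAlgebra p) (hL : ∀ n, PowerSeries.map (φ n) G = C (p : ℤ_[p]) * L n)
    {n m : ℕ} (hnm : n ≡ m [MOD p])
    (hn0 : PowerSeries.map ((residue ℤ_[p]).comp constantCoeff) A +
      (n : ResidueField ℤ_[p]) • PowerSeries.map ((residue ℤ_[p]).comp constantCoeff) B ≠ 0) :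
    lam (L n) = lam (L m) := by
  have hC : (C (p : ℤ_[p]) : IwasawaAlgebra p) ≠ 0 := by
    have := C_pow_ne_zero (p := p) 1
    rwa [pow_one] at this
  have key : ∀ k, red (L k) = PowerSeries.map ((residue ℤ_[p]).comp constantCoeff) A +
      (k : ResidueField ℤ_[p]) • PowerSeries.map ((residue ℤ_[p]).comp constantCoeff) B := by
    intro k
    obtain ⟨t, -, hmap, hred⟩ := exists_bracket_weight hG (φ k) (hφ k)
    have hLk : L k = PowerSeries.map (φ k) A + C t * PowerSeries.map (φ k) B :=
      mul_left_cancel₀ hC ((hL k).symm.trans hmap)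
    rw [hLk, hred]
  exact WeightResiduePencil.lam_eq_lam_of_modEq L _ _ (key n) (key m) hn0 hnm

/-! ## §7. The weight points exist: `φ_n = ev_{(1+p)^n − 1}` (Mathlib evaluation, tree `evalHom`) -/

/-- The weight point `(1+p)^n − 1` lies in the open unit disc `pℤ_p`. [folklore] -/
theorem norm_weightPoint_lt_one (n : ℕ) : ‖(1 + (p : ℤ_[p])) ^ n - 1‖ < 1 := by
  obtain ⟨t, ht, -⟩ := WeightResiduePencil.exists_weightQuotient (p := p) n
  rw [ht, PadicInt.norm_lt_one_iff_dvd]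
  exact Dvd.intro t rfl

/-- **The weight-`(n+2)` specialisation as a ring map `ℤ_p⟦S⟧ → ℤ_p`**: the tree's `evalHom` (Mathlib's
`PowerSeries.eval₂Hom` at a topologically nilpotent point) at `s = (1+p)^n − 1` sends `S ↦ s`; so the
hypothesis `φ X = (1+p)^n − 1` of §6 is inhabited for every `n`, not only by `S ↦ 0`.
[cite: GreenbergStevens1993, Thm. (6.1), p. 438 (weight specialisation, memo level)] -/
theorem evalHom_weightPoint_X (n : ℕ) :
    evalHom ((1 + (p : ℤ_[p])) ^ n - 1) (norm_weightPoint_lt_one n) X = (1 + (p : ℤ_[p])) ^ n - 1 := by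
  rw [evalHom_apply, PowerSeries.eval₂_X]

/-- **`λ` of the β-branch member at the ACTUAL weight points depends on `n mod p` only** —
`lam_bracket_eq_of_modEq` with `φ n := evalHom ((1+p)^n − 1)`. [folklore] -/
theorem lam_bracket_evalHom_eq_of_modEq {G A B : PowerSeries (PowerSeries ℤ_[p])}
    (hG : G = C (C (p : ℤ_[p])) * A + C (X : PowerSeries ℤ_[p]) * B)
    (L : ℕ → IwasawaAlgebra p)
    (hL : ∀ n, PowerSeries.map (evalHom ((1 + (p : ℤ_[p])) ^ n - 1) (norm_weightPoint_lt_one n)) G =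
      C (p : ℤ_[p]) * L n)
    {n m : ℕ} (hnm : n ≡ m [MOD p])
    (hn0 : PowerSeries.map ((residue ℤ_[p]).comp constantCoeff) A +
      (n : ResidueField ℤ_[p]) • PowerSeries.map ((residue ℤ_[p]).comp constantCoeff) B ≠ 0) :
    lam (L n) = lam (L m) :=
  lam_bracket_eq_of_modEq hG (fun n ↦ evalHom ((1 + (p : ℤ_[p])) ^ n - 1) (norm_weightPoint_lt_one n))
    evalHom_weightPoint_X L hL hnm hn0

/-- **§8 (append). MEMO-24 §1 (b)(iii): «`v(c_{x_k}) = 1` EXACTLY — in the family normalisation every member has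
`μ = 1`, in the primitive one `μ = 0`».** For `G = p·A + S·B`, `φ(S) = p·t` and a non-zero pencil
member `Ā + t̄·B̄`: `μ(map φ G) = 1`, the `p`-free part of `map φ G` IS the bracket `A_φ + t·B_φ`, the
bracket has `μ = 0`, and `λ(map φ G) = λ(bracket)` (`X1.MuLambda.mu_eq_and_pfree_eq` + §6). [folklore] -/
theorem mu_map_eq_one_of_two_line {G A B : PowerSeries (PowerSeries ℤ_[p])}
    (hG : G = C (C (p : ℤ_[p])) * A + C (X : PowerSeries ℤ_[p]) * B)
    (φ : PowerSeries ℤ_[p] →+* ℤ_[p]) {t : ℤ_[p]} (hφ : φ X = (p : ℤ_[p]) * t)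
    (hne : PowerSeries.map ((residue ℤ_[p]).comp constantCoeff) A +
      residue ℤ_[p] t • PowerSeries.map ((residue ℤ_[p]).comp constantCoeff) B ≠ 0) :
    mu (PowerSeries.map φ G) = 1 ∧
      pfree (PowerSeries.map φ G) = PowerSeries.map φ A + C t * PowerSeries.map φ B ∧
      mu (PowerSeries.map φ A + C t * PowerSeries.map φ B) = 0 ∧
      lam (PowerSeries.map φ G) = lam (PowerSeries.map φ A + C t * PowerSeries.map φ B) := by
  have hred : red (PowerSeries.map φ A + C t * PowerSeries.map φ B) ≠ 0 := by rwa [red_bracket]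
  have hfac : PowerSeries.map φ G =
      C ((p : ℤ_[p]) ^ 1) * (PowerSeries.map φ A + C t * PowerSeries.map φ B) := by
    rw [pow_one]; exact map_two_line_eq_C_mul_bracket hG φ hφ
  obtain ⟨hμ, hpf⟩ := mu_eq_and_pfree_eq hred hfac
  have hpf0 : pfree (PowerSeries.map φ A + C t * PowerSeries.map φ B) =
      PowerSeries.map φ A + C t * PowerSeries.map φ B :=
    (mu_eq_and_pfree_eq (a := 0) hred (by rw [pow_zero, map_one, one_mul])).2
  refine ⟨hμ, hpf, (Rank1Residual.Supersingular.mu_eq_zero_and_lam_eq_of_red_ne_zero hred).1, ?_⟩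
  rw [lam, lam, hpf, hpf0]

end Summit.BirchSwinnertonDyer.BirchSwinnertonDyer.Theorems.HidaSpecialisationRigidity

end
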